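import Summits.BirchSwinnertonDyer.Rank1Residual.X9.PrintCertHowardCertifiedX10bX9Ns
import Summits.BirchSwinnertonDyer.Rank1Residual.X9.PrintCertHowardCertifiedX9S4AB
import Summits.BirchSwinnertonDyer.Rank1Residual.X9.PrintCertHowardCertifiedX9S4CD
import Summits.BirchSwinnertonDyer.Rank1Residual.X9.PrintCertHeegnerCensus
import HarnessLib

/-!
# Leaves X9 / X10b — HOWARD FRAMES over the full census lists `allX9` / `allX10b` (records v4, one-stop theorems)

HONEST FRAMING (cell `bsd-print-x9`, D-0131 (2) print tier): theorems and two list abbreviations; no named fact; nothing asserted about any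
elliptic curve beyond what the kernel rechecks; no pair is booked and no leaf is closed (`BSDpOnClassX9`, `BSDpOnClassX10b` stay `@[conjecture]`;
cruxes J = item 20392, J₃ = item 21340 and the μ-cruxes 19629/19630/20682 stay OPEN; the J-free Howard road of prover p4 is a road, not a closure).

USE (by name; `r ∈ allX9` resp. `allX10b` from `X9/PrintCertTamagawaCensus.lean`, `h1 : r.rank = 1`, `hI : integralModelInt W = r.intCurve`,
`hK : IsImaginaryQuadratic K`, `hq : q = r.p`):
`howardFrame_of_mem_allX9 hr h1 hI hK hq : ∃ c ∈ howardCertsAllX9, r.howardCheck c = true ∧ (NumberField.discr K = c.D →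
  (SatisfiesHeegnerHypothesis (W.conductorNorm ℤ) K ∧ SatisfiesHeegnerHypothesis q K ∧ 4 < |d_K| ∧ 4N ∣ β² − d_K ∧ (q = 3 → d_K % 8 = 1)) ∧
  Odd d_K ∧ (d_K ≠ -3 ∧ d_K ≠ -4) ∧ ¬ q ∣ NumberField.classNumber K)` — the `K`-side hypotheses `hHeeg`, `hHp`, `hne`, `hh` of
`ClassX9.mz26Hypotheses` (file `X9/LeafDischargeScalarImage.lean`) and `hHN`, `hHp`, `hodd`, `h3`, `hhK` of
`YanZhu2026.thm57_thm59_bcs422_cgls513_generator_constantCoeff_of_heegnerDivisibility`, for every rank-`1` X9 pair of the census, on an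
explicit `K = ℚ(√D)`; `howardFrame_of_mem_allX10b` likewise (`p = 3`, `d_K ≡ 1 (mod 8)`). What stays a CLAIM of the display files: `m_K` is the
Heegner index, `#Ш_an(E^D)`, `L(E^D,1) ≠ 0` (i.e. `y_K` non-torsion), `#E(K)_tors`, `N(W) = r.conductor`; what is KERNEL: all frame arithmetic,
`ord_p ∏ c_ℓ(W)`, and now `h(d_K)` with `p ∤ h_K`.

NUMBERS (kernel census below + `gen/stats_v4.json` of seat `bsd-print-x9-ty3` gen 4): X9 — 510 Howard frame certificates (411 re-used records-v3
frames + 99 new) for the 415 rank-`1` records, 50 distinct `D`, `|D| ≤ 2399`; X10b — 70 certificates (65 + 5 new) for the 39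
rank-`1` records, 28 distinct `D`, `|D| ≤ 2279`. New frames' J-screen: X9 `v = t` 91 / `v > t` 8 / `v < t` 0; X10b 5 / 0 / 0.
-/

set_option autoImplicit false

namespace Summit.BirchSwinnertonDyer.Rank1Residual.X9.PrintCert

open WeierstrassCurve Summit.BirchSwinnertonDyer.Rank1Residual.Additive
open Literature.NumberTheory.EllipticCurves (IsImaginaryQuadratic SatisfiesHeegnerHypothesis)

/-- All Howard frame certificates of the rank-`1` X9 records (slices `Ns5A`, `Ns5B`, `Ns7`, `S4R1A`–`D`, in this order). [folklore] -/
def howardCertsAllX9 : List HeegnerCert :=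
  howardCertsNs5A ++ howardCertsNs5B ++ howardCertsNs7 ++ howardCertsS4R1A ++ howardCertsS4R1B ++ howardCertsS4R1C ++ howardCertsS4R1D

/-- All Howard frame certificates of the rank-`1` X10b records (slice `X10bNsR1`). [folklore] -/
abbrev howardCertsAllX10b : List HeegnerCert := howardCertsX10bNsR1

-- kernel evaluation over all records
set_option maxRecDepth 100000

/-- **Every rank-`1` X9 record has a passing Howard frame certificate** (`D` odd, `p ∤ h(D)` recomputed by the kernel). [cite: MastellaZerman2026, Assumption 2.1] -/
theorem exists_howardCheck_of_mem_allX9 {r : Record} (hr : r ∈ allX9) (h1 : r.rank = 1) :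
    ∃ c ∈ howardCertsAllX9, r.howardCheck c = true := by
  obtain ⟨h0A, h0B, h0C, -, -, -⟩ := rank_ne_one_of_rankZero_slices
  simp only [allX9, List.mem_append] at hr
  simp only [howardCertsAllX9, List.mem_append]
  rcases hr with ((((((((h | h) | h) | h) | h) | h) | h) | h) | h) | h
  · obtain ⟨c, hc, hh⟩ := exists_howardCheck_of_mem_Ns5A h h1; exact ⟨c, by tauto, hh⟩
  · obtain ⟨c, hc, hh⟩ := exists_howardCheck_of_mem_Ns5B h h1; exact ⟨c, by tauto, hh⟩
  · obtain ⟨c, hc, hh⟩ := exists_howardCheck_of_mem_Ns7 h h1; exact ⟨c, by tauto, hh⟩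
  · exact absurd h1 (h0A r h)
  · exact absurd h1 (h0B r h)
  · exact absurd h1 (h0C r h)
  · obtain ⟨c, hc, hh⟩ := exists_howardCheck_of_mem_S4R1A h h1; exact ⟨c, by tauto, hh⟩
  · obtain ⟨c, hc, hh⟩ := exists_howardCheck_of_mem_S4R1B h h1; exact ⟨c, by tauto, hh⟩
  · obtain ⟨c, hc, hh⟩ := exists_howardCheck_of_mem_S4R1C h h1; exact ⟨c, by tauto, hh⟩
  · obtain ⟨c, hc, hh⟩ := exists_howardCheck_of_mem_S4R1D h h1; exact ⟨c, by tauto, hh⟩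

/-- **Every rank-`1` X10b record has a passing Howard frame certificate** (`d_K ≡ 1 (mod 8)`, `3 ∤ h(D)` recomputed by the kernel). [cite: MastellaZerman2026, Assumption 2.1] -/
theorem exists_howardCheck_of_mem_allX10b {r : Record} (hr : r ∈ allX10b) (h1 : r.rank = 1) :
    ∃ c ∈ howardCertsAllX10b, r.howardCheck c = true := by
  obtain ⟨-, -, -, hNn, hA, hB⟩ := rank_ne_one_of_rankZero_slices
  simp only [allX10b, List.mem_append] at hr
  rcases hr with ((h | h) | h) | h
  · exact absurd h1 (hNn r h)
  · exact absurd h1 (hA r h)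
  · exact absurd h1 (hB r h)
  · exact exists_howardCheck_of_mem_X10bNsR1 h h1

/-- **THE HOWARD FRAME over `allX9`**: for a rank-`1` record, ANY imaginary quadratic `K` with the certificate's discriminant satisfies, for ANY globally
minimal `W` with the record's integral model, the records-v3 frame binders (Heegner for `N(W)` and for `p`, `|d_K| > 4`, `4N ∣ β² − d_K`) AND `Odd d_K`,
`d_K ≠ -3, -4`, `¬ p ∣ h_K` — the `K`-side hypotheses of `ClassX9.mz26Hypotheses` and of the YZ26 composite, IN THE KERNEL.
[cite: MastellaZerman2026, Assumption 2.1, Cor. 4.6] [cite: Cox2013, §7.B Thm. 7.7(ii)] [cite: GrossLMS1991, §1 (p. 235)] -/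
theorem howardFrame_of_mem_allX9 {r : Record} (hr : r ∈ allX9) (h1 : r.rank = 1) {W : WeierstrassCurve ℚ} [W.IsElliptic]
    [W.IsGloballyMinimal] (hI : integralModelInt W = r.intCurve) {K : Type} [Field K] [NumberField K]
    (hK : IsImaginaryQuadratic K) {q : ℕ} (hq : q = r.p) :
    ∃ c ∈ howardCertsAllX9, r.howardCheck c = true ∧ (NumberField.discr K = c.D →
      (SatisfiesHeegnerHypothesis (W.conductorNorm ℤ) K ∧ SatisfiesHeegnerHypothesis q K ∧ 4 < (NumberField.discr K).natAbs ∧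
        (4 * (r.conductor : ℤ)) ∣ (c.beta : ℤ) ^ 2 - NumberField.discr K ∧ (q = 3 → NumberField.discr K % 8 = 1)) ∧
      Odd (NumberField.discr K) ∧ (NumberField.discr K ≠ -3 ∧ NumberField.discr K ≠ -4) ∧ ¬ q ∣ NumberField.classNumber K) := by
  obtain ⟨c, hc, hh⟩ := exists_howardCheck_of_mem_allX9 hr h1
  exact ⟨c, hc, hh, fun hd => Record.howardFrame_of_howardCheck hI (check_of_mem_allX9 hr) hh hK hd hq⟩

/-- **THE HOWARD FRAME over `allX10b`** (`p = 3`; the frame has `d_K ≡ 1 (mod 8)`). [cite: MastellaZerman2026, Assumption 2.1, Cor. 4.6]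
[cite: Cox2013, §7.B Thm. 7.7(ii)] [cite: GrossLMS1991, §1 (p. 235)] -/
theorem howardFrame_of_mem_allX10b {r : Record} (hr : r ∈ allX10b) (h1 : r.rank = 1) {W : WeierstrassCurve ℚ} [W.IsElliptic]
    [W.IsGloballyMinimal] (hI : integralModelInt W = r.intCurve) {K : Type} [Field K] [NumberField K]
    (hK : IsImaginaryQuadratic K) {q : ℕ} (hq : q = r.p) :
    ∃ c ∈ howardCertsAllX10b, r.howardCheck c = true ∧ (NumberField.discr K = c.D →
      (SatisfiesHeegnerHypothesis (W.conductorNorm ℤ) K ∧ SatisfiesHeegnerHypothesis q K ∧ 4 < (NumberField.discr K).natAbs ∧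
        (4 * (r.conductor : ℤ)) ∣ (c.beta : ℤ) ^ 2 - NumberField.discr K ∧ (q = 3 → NumberField.discr K % 8 = 1)) ∧
      Odd (NumberField.discr K) ∧ (NumberField.discr K ≠ -3 ∧ NumberField.discr K ≠ -4) ∧ ¬ q ∣ NumberField.classNumber K) := by
  obtain ⟨c, hc, hh⟩ := exists_howardCheck_of_mem_allX10b hr h1
  exact ⟨c, hc, hh, fun hd => Record.howardFrame_of_howardCheck hI (check_of_mem_allX10b hr) hh hK hd hq⟩

/-- The Howard frame (as a records-v3 frame) also carries the J-SCREEN in the kernel's currency (`ord_p ∏ c_ℓ(W) ≤ v_p(m_K)`, GZ–BSD identity),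
over `allX9`. [cite: Jetchev2008, Conj. 1.1, Thm. 1.4] -/
theorem howardScreen_of_mem_allX9 {r : Record} (hr : r ∈ allX9) (h1 : r.rank = 1) {W : WeierstrassCurve ℚ} [W.IsElliptic]
    [W.IsGloballyMinimal] (hI : integralModelInt W = r.intCurve) {q : ℕ} (hq : q = r.p) :
    ∃ c ∈ howardCertsAllX9, r.howardCheck c = true ∧ padicValNat q W.tamagawaProduct ≤ c.indexVal ∧
      2 * c.indexVal = 2 * padicValNat q W.tamagawaProduct + padicValNat q (r.shaAn * c.twistSha) := by
  obtain ⟨c, hc, hh⟩ := exists_howardCheck_of_mem_allX9 hr h1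
  obtain ⟨tc, htc⟩ := exists_tamCheck_of_mem_allX9 hr
  exact ⟨c, hc, hh, Record.padicValNat_tamagawaProduct_le_indexVal_of_heegnerCheck hI (Record.heegnerCheck_of_howardCheck hh) htc hq,
    Record.two_mul_indexVal_eq_of_heegnerCheck hI (Record.heegnerCheck_of_howardCheck hh) htc hq⟩

/-- KERNEL CENSUS over both leaves: `howardCertsAllX9` has 510 certificates (99 new), `howardCertsAllX10b` 70 (5 new); every certificate has `D` odd
and `p ∤ classNumber` (the display-list invariant; the VALUE `h(D)` is rechecked per record by `howardScreen_<Slice>`); `|D| ≤ 2399` resp. `≤ 2279`. [folklore] -/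
theorem howardCensus_all : howardCertsAllX9.length = 510 ∧ howardCertsAllX10b.length = 70 ∧
    (howardCertsNewNs5A ++ howardCertsNewNs5B ++ howardCertsNewNs7 ++ howardCertsNewS4R1A ++ howardCertsNewS4R1B ++ howardCertsNewS4R1C ++
      howardCertsNewS4R1D).length = 99 ∧ howardCertsNewX10bNsR1.length = 5 ∧
    (howardCertsAllX9.all fun c => decide (c.D % 2 ≠ 0) && decide (¬ c.p ∣ c.classNumber) && decide (c.D.natAbs ≤ 2399)) = true ∧
    (howardCertsAllX10b.all fun c => decide (c.D % 8 = 1) && decide (¬ 3 ∣ c.classNumber) && decide (c.D.natAbs ≤ 2279)) = true := by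
  refine ⟨?_, ?_, ?_, ?_, ?_, ?_⟩ <;> decide +kernel

end Summit.BirchSwinnertonDyer.Rank1Residual.X9.PrintCert
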